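import Summits.RiemannHypothesis.RiemannHypothesis.Theorems.TiltedLandingLaw421R3MenuThinNF
import Summits.RiemannHypothesis.RiemannHypothesis.Theorems.TiltedLandingLaw421R3SinkLemmaHThin

noncomputable section

/-! # «MenuThinEdge» — W-09 β′ E5, the EDGE residual of the thin menu law is a THEOREM (explicit multiplier)
ns `RhW08.MenuThinEdge`; SUPPORT for ⟨stmt-RiemannHypothesis-33346⟩ (lead files).  Imports «MenuThinNF» + #1304 «SinkLemmaHThin» (C1's `lemmaHThin`).

On the nesting circle `δ² + t² = Y²` the datum kernel is REAL (`Im K = 0`, `Re K > 0`), so the rule-A foot numerator collapses to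
`N_A(u) = Re K_u(p₀) − Re K_u(w)` (`footANumForm_edge`) and the (D)-alternative of the A-member holds for EVERY multiplier once `1 ≤ lam`.
The boundary domination is witnessed by the EXPLICIT multiplier `sigmaE δ t = δ(4t² + 8)/t³`: per term
`Re`-difference `≤ 2δ/E±` (`reTerm_sub_le`, `|ξ| ≥ 1 > δ ≥ 0`), `c = 2t((δ−ξ)² + t² − b²)/(E₋E₊)` (#1279 `pairCForm_mul`) and one polynomial
inequality (`edge_dom_point`, needs `b² ≤ 1`, `b² ≤ (δ − ξ)²` — true on all four pieces of the thin boundary at `R = 2`, lid `1 − h`).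
★ `menuThinNFEdgeSig_of_one_le : 1 ≤ lam → MenuThinNFEdgeSig lam`; ★★ `menuThinNFRealSig_of_certForm'` (CERTIFICATE FORM ALONE ⇒ menu law) and the
by-name chain to E2 `certificatesExistThinSig_of_certForm` / `…_of_kitCertForm` (SOLE hypothesis: `MenuThinCertFormSig lam κ`; thin Lemma H is C1's
tree theorem `lemmaHThin`, #1304).  Nothing here asserts the certificate form; RH is NOT proved; ⟨33346⟩/⟨33347⟩ OPEN; checked ≠ keyed ≠ landed ≠ proved. -/

namespace RhW08.MenuThinEdge

open RhW08.SinkBdry RhW08.SinkConePos RhW08.SinkThin RhW08.MenuThin RhW08.MenuThinNF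

/-! ## §1 The per-term real-part difference and its bound -/

/-- difference identity for `f_a(x) = (x − ξ)/((x − ξ)² + a²)` between `x = 0` and `x = δ`. -/
theorem reTerm_sub (δ ξ a : ℝ) (hE : (δ - ξ) ^ 2 + a ^ 2 ≠ 0) (hE0 : ξ ^ 2 + a ^ 2 ≠ 0) :
    (0 - ξ) / ((0 - ξ) ^ 2 + a ^ 2) - (δ - ξ) / ((δ - ξ) ^ 2 + a ^ 2) =
      δ * (ξ * (ξ - δ) - a ^ 2) / (((δ - ξ) ^ 2 + a ^ 2) * (ξ ^ 2 + a ^ 2)) := by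
  have hE0' : (0 - ξ) ^ 2 + a ^ 2 ≠ 0 := by rwa [zero_sub, neg_sq]
  rw [div_sub_div _ _ hE0' hE, div_eq_div_iff (mul_ne_zero hE0' hE) (mul_ne_zero hE hE0)]
  ring

/-- per-term bound for `|ξ| ≥ 1 > δ ≥ 0`: `f_a(0) − f_a(δ) ≤ 2δ/((δ − ξ)² + a²)`. -/
theorem reTerm_sub_le {δ ξ : ℝ} (a : ℝ) (hδ : 0 ≤ δ) (hδ1 : δ < 1) (hξ : 1 ≤ |ξ|) :
    (0 - ξ) / ((0 - ξ) ^ 2 + a ^ 2) - (δ - ξ) / ((δ - ξ) ^ 2 + a ^ 2) ≤ 2 * δ / ((δ - ξ) ^ 2 + a ^ 2) := by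
  have hξδ : 0 ≤ ξ ^ 2 + ξ * δ := by
    rcases le_or_gt 0 ξ with h | h
    · positivity
    · rw [abs_of_neg h] at hξ
      nlinarith
  have hsq : 0 < (δ - ξ) ^ 2 := by
    rcases le_or_gt 0 ξ with h | h
    · rw [abs_of_nonneg h] at hξ
      have : 0 < ξ - δ := by linarith
      nlinarith
    · have : 0 < δ - ξ := by linarith
      positivity
  have hE : 0 < (δ - ξ) ^ 2 + a ^ 2 := by positivity
  have hE0 : 0 < ξ ^ 2 + a ^ 2 := by
    have : 0 < ξ ^ 2 := by
      have hξ0 : ξ ≠ 0 := by rintro rfl; simp at hξ; linarith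
      positivity
    positivity
  rw [reTerm_sub δ ξ a hE.ne' hE0.ne', div_le_div_iff₀ (mul_pos hE hE0) hE]
  have key : 0 ≤ δ * ((δ - ξ) ^ 2 + a ^ 2) * (ξ ^ 2 + ξ * δ + 3 * a ^ 2) :=
    mul_nonneg (mul_nonneg hδ hE.le) (by nlinarith [sq_nonneg a])
  nlinarith [key]

/-- the EDGE numerator bound: `Re K_u(p₀) − Re K_u(w) ≤ 2δ/E₋ + 2δ/E₊` for `|ξ| ≥ 1 > δ ≥ 0`. -/
theorem pairReForm_sub_le {δ ξ : ℝ} (t b : ℝ) (hδ : 0 ≤ δ) (hδ1 : δ < 1) (hξ : 1 ≤ |ξ|) :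
    pairReForm 0 t ξ b - pairReForm δ t ξ b ≤ 2 * δ / ((δ - ξ) ^ 2 + (t - b) ^ 2) + 2 * δ / ((δ - ξ) ^ 2 + (t + b) ^ 2) := by
  have h1 := reTerm_sub_le (t - b) hδ hδ1 hξ
  have h2 := reTerm_sub_le (t + b) hδ hδ1 hξ
  unfold pairReForm
  linarith

/-! ## §2 The explicit multiplier and the pointwise domination -/

/-- the EDGE multiplier `σ_E = δ(4t² + 8)/t³`. -/
def sigmaE (δ t : ℝ) : ℝ := δ * (4 * t ^ 2 + 8) / t ^ 3

/-- POINTWISE DOMINATION at a boundary point `(ξ, b)` with `|ξ| ≥ 1`, `b² ≤ 1`, `b² ≤ (δ − ξ)²` (child `0 ≤ δ < 1`, `0 < t`):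
`Re K_u(p₀) − Re K_u(w) ≤ σ_E · c(u)`. -/
theorem edge_dom_point {δ t ξ b : ℝ} (ht : 0 < t) (hδ : 0 ≤ δ) (hδ1 : δ < 1) (hξ : 1 ≤ |ξ|) (hb : b ^ 2 ≤ 1) (hq : b ^ 2 ≤ (δ - ξ) ^ 2) :
    pairReForm 0 t ξ b - pairReForm δ t ξ b ≤ sigmaE δ t * pairCForm δ t ξ b := by
  have hsq : 0 < (δ - ξ) ^ 2 := by
    rcases le_or_gt 0 ξ with h | h
    · rw [abs_of_nonneg h] at hξ
      have : 0 < ξ - δ := by linarith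
      nlinarith
    · have : 0 < δ - ξ := by linarith
      positivity
  have hEm : 0 < (δ - ξ) ^ 2 + (t - b) ^ 2 := by positivity
  have hEp : 0 < (δ - ξ) ^ 2 + (t + b) ^ 2 := by positivity
  have hc := pairCForm_mul δ t ξ b hEm.ne' hEp.ne'
  refine (pairReForm_sub_le t b hδ hδ1 hξ).trans ?_
  rw [div_add_div _ _ hEm.ne' hEp.ne', div_le_iff₀ (mul_pos hEm hEp), mul_assoc (sigmaE δ t) (pairCForm δ t ξ b), hc, sigmaE,
    div_mul_eq_mul_div, le_div_iff₀ (pow_pos ht 3)]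
  have key : 0 ≤ 2 * δ * t * (2 * t ^ 2 * ((δ - ξ) ^ 2 - b ^ 2) + 8 * ((δ - ξ) ^ 2 - b ^ 2) + 2 * t ^ 4 + 4 * t ^ 2 * (1 - b ^ 2) + 4 * t ^ 2) :=
    mul_nonneg (by positivity) (by nlinarith [sq_nonneg t])
  nlinarith [key]

/-! ## §3 The edge datum: real kernel, collapsed numerator -/

/-- ON the nesting circle `Im K = 0` (#1279 `pairCForm_mul` at `ξ = 0`, `b = Y`). -/
theorem kerIm_edge {δ t Y : ℝ} (hedge : δ ^ 2 + t ^ 2 = Y ^ 2) (ht : 0 < t) (htY : t < Y) : kerIm δ t Y = 0 := by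
  have hm : 0 < (δ - 0) ^ 2 + (t - Y) ^ 2 := by nlinarith [sq_nonneg δ]
  have hp : 0 < (δ - 0) ^ 2 + (t + Y) ^ 2 := by nlinarith [sq_nonneg δ]
  have h0 : pairCForm δ t 0 Y * (((δ - 0) ^ 2 + (t - Y) ^ 2) * ((δ - 0) ^ 2 + (t + Y) ^ 2)) = 0 := by
    rw [pairCForm_mul δ t 0 Y hm.ne' hp.ne', sub_zero, hedge, sub_self, mul_zero]
  rcases mul_eq_zero.1 h0 with h | h
  · rw [kerIm, h, neg_zero]
  · exact absurd h (mul_pos hm hp).ne'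

/-- ON the nesting circle the child is strictly to the right (`0 < δ`) and `Re K > 0`. -/
theorem kerRe_edge_pos {δ t Y : ℝ} (hedge : δ ^ 2 + t ^ 2 = Y ^ 2) (ht : 0 < t) (htY : t < Y) (hδ : 0 ≤ δ) : 0 < kerRe δ t Y := by
  have hδ0 : 0 < δ := by
    rcases hδ.lt_or_eq with h | h
    · exact h
    · rw [← h] at hedge; nlinarith
  have hm : 0 < δ ^ 2 + (t - Y) ^ 2 := by positivity
  have hp : 0 < δ ^ 2 + (t + Y) ^ 2 := by positivity
  rw [kerRe, pairReForm, sub_zero]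
  exact add_pos (div_pos hδ0 hm) (div_pos hδ0 hp)

/-- ON the nesting circle `‖K‖ = Re K`. -/
theorem kerNorm_edge {δ t Y : ℝ} (hedge : δ ^ 2 + t ^ 2 = Y ^ 2) (ht : 0 < t) (htY : t < Y) (hδ : 0 ≤ δ) : kerNorm δ t Y = kerRe δ t Y := by
  rw [kerNorm, kerIm_edge hedge ht htY, zero_pow two_ne_zero, add_zero, Real.sqrt_sq (kerRe_edge_pos hedge ht htY hδ).le]

/-- ON the nesting circle the rule-A foot numerator collapses to the real-part difference `Re K_u(p₀) − Re K_u(w)`. -/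
theorem footANumForm_edge {δ t Y : ℝ} (hedge : δ ^ 2 + t ^ 2 = Y ^ 2) (ht : 0 < t) (htY : t < Y) (hδ : 0 ≤ δ) (ξ b : ℝ) :
    footANumForm δ t Y ξ b = pairReForm 0 t ξ b - pairReForm δ t ξ b := by
  have hRe := kerRe_edge_pos hedge ht htY hδ
  rw [footANumForm, kerIm_edge hedge ht htY, kerNorm_edge hedge ht htY hδ, zero_mul, add_zero, mul_div_cancel_left₀ _ hRe.ne']
  ring

/-! ## §4 The edge residual is a theorem -/

/-- (K∂_thin) for the A-read ON the nesting circle, with the explicit multiplier `σ_E`. -/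
theorem thinBdryDomFormA_edge {s h δ t Y : ℝ} (hs : 0 < s) (hsh : 2 * s ≤ h) (h3 : 3 * h < 2) (hYh : Y ≤ h) (ht : 0 < t) (htY : t < Y)
    (hedge : δ ^ 2 + t ^ 2 = Y ^ 2) (hδ : 0 ≤ δ) : ThinBdryDomFormA 2 (1 - h) δ t Y (sigmaE δ t) := by
  have hδY : δ ≤ Y := by nlinarith
  have hδ1 : δ < 1 := by linarith
  have hN := footANumForm_edge hedge ht htY hδ
  refine ⟨fun b hb0 hbH => ?_, fun b hb0 hbH => ?_, fun ξ hξ => ?_, fun ξ hξ => ?_⟩ <;> rw [hN]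
  · exact edge_dom_point ht hδ hδ1 (by norm_num) (by nlinarith) (by nlinarith)
  · exact edge_dom_point ht hδ hδ1 (by norm_num) (by nlinarith) (by nlinarith)
  · exact edge_dom_point ht hδ hδ1 (by rw [abs_of_pos (by linarith)]; linarith) (by nlinarith) (by nlinarith)
  · exact edge_dom_point ht hδ hδ1 (by rw [abs_of_neg (by linarith)]; linarith) (by nlinarith) (by nlinarith)

/-- ★ THE EDGE RESIDUAL IS A THEOREM for `1 ≤ lam`: on the nesting circle the A-member certifies with `σ_E` (and the first (D)-alternative,
`‖K‖/lam ≤ ‖K‖`, holds for every multiplier since `Im K = 0`). -/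
theorem menuThinNFEdgeSig_of_one_le {lam : ℝ} (hlam : 1 ≤ lam) : MenuThinNFEdgeSig lam := by
  intro s h δ t Y hs hsh h3 _hY hYh ht htY _hdrop hedge hδ
  refine Or.inl ⟨sigmaE δ t, thinBdryDomFormA_edge hs hsh h3 hYh ht htY hedge hδ, Or.inl ?_⟩
  rw [kerIm_edge hedge ht htY, mul_zero, sub_zero]
  exact div_le_self (kerNorm_nonneg _ _ _) hlam

/-- ★★ CERTIFICATE FORM ALONE ⇒ the `R = 2` menu law (`1 ≤ lam`, `0 ≤ κ`, `1/lam ≤ 1 − κ`). -/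
theorem menuThinNFRealSig_of_certForm' {lam κ : ℝ} (hlam : 1 ≤ lam) (hκ0 : 0 ≤ κ) (hκ : 1 / lam ≤ 1 - κ)
    (hC : MenuThinCertFormSig lam κ) : MenuThinNFRealSig lam :=
  menuThinNFRealSig_of_certForm hκ0 hκ hC (menuThinNFEdgeSig_of_one_le hlam)

/-- ★★ BY-NAME CHAIN TO E2: the certificate form ALONE ⇒ C1's `RhW08.SinkThin.CertificatesExistThinSig lam` (#1303 «SinkThinSig»; thin Lemma H =
C1's `RhW08.SinkThin.lemmaHThin`, #1304 «SinkLemmaHThin»; left children by `thinMirrorSig`). -/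
theorem certificatesExistThinSig_of_certForm {lam κ : ℝ} (hlam : 1 ≤ lam) (hκ0 : 0 ≤ κ) (hκ : 1 / lam ≤ 1 - κ) (hC : MenuThinCertFormSig lam κ) :
    CertificatesExistThinSig lam :=
  certificatesExistThinSig_of_NF (by linarith) lemmaHThin (menuThinNFRealSig_of_certForm' hlam hκ0 hκ hC)

/-- the kit's `lam = √5/2` clears `1 ≤ lam`. -/
theorem one_le_kit_lam : 1 ≤ Real.sqrt 5 / 2 := by
  have h5 : (2 : ℝ) ≤ Real.sqrt 5 := Real.le_sqrt_of_sq_le (by norm_num)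
  linarith

/-- ★★ THE KIT INSTANCE: `MenuThinCertFormSig (√5/2) (27/256)` ALONE ⇒ E2's thin law at `lam = √5/2` (the shape «rh33346-thincert» checks, on its
covered sub-box; the law on the whole box stays OPEN and is asserted by nothing here). -/
theorem certificatesExistThinSig_of_kitCertForm (hC : MenuThinCertFormSig (Real.sqrt 5 / 2) (27 / 256)) :
    CertificatesExistThinSig (Real.sqrt 5 / 2) :=
  certificatesExistThinSig_of_certForm one_le_kit_lam (by norm_num) kit_ratio_admissible hC

end RhW08.MenuThinEdge

end
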